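import Mathlib
import Summits.MatrixMultiplication.MatrixMultiplication.Theorems.SoloBlindFlatBridge

/-!
# The K♭ / E♭ checker: the greedy `d`-certificate is a dimension lower bound

`SoloBlindFlatCheck` computes `d = soloBlindFlatD T m F C₀` greedily: a member `M` is appended to the
chosen list `ch` when some letter vector `w < 3^m` separates it (`w · (1_M - 1_{C₀}) ≠ 0` while
`w · (1_{M'} - 1_{C₀}) = 0` for all chosen `M'`).  Reading `w` as the linear functional
`v ↦ ∑_a dig(w, a) v(a)` on `(Fin m → ZMod 3)`, each accepted step strictly enlarges the span of the
difference vectors `1_{M} - 1_{C₀}`; hence `d ≤ dim span {1_M - 1_{C₀} : M ∈ F} ≤ m`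
(`soloBlind_flatD_le_finrank`, `soloBlind_flatD_le`).
-/

namespace Summit.MatrixMultiplication.MatrixMultiplication.Theorems

open Finset Module

/-- The difference vector `1_M - 1_{C₀}` of decoded masks in `(Fin m → ZMod 3)`. -/
noncomputable def soloBlindVDiff (m M C₀ : ℕ) : Fin m → ZMod 3 :=
  (↑(soloBlindDecSet m M) : Set (Fin m)).indicator 1 - (↑(soloBlindDecSet m C₀) : Set (Fin m)).indicator 1

/-- The difference vectors of a list of masks. -/
def soloBlindVSet (m C₀ : ℕ) (ch : List ℕ) : Set (Fin m → ZMod 3) :=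
  {v | ∃ M ∈ ch, v = soloBlindVDiff m M C₀}

/-- The test functional of the letter code `w`: `v ↦ ∑_a dig(w, a) · v(a)`. -/
noncomputable def soloBlindDigFun (m w : ℕ) : (Fin m → ZMod 3) →ₗ[ZMod 3] ZMod 3 :=
  ∑ a : Fin m, soloBlindDig w a • LinearMap.proj a

/-- Evaluation of the test functional. -/
theorem soloBlindDigFun_apply (m w : ℕ) (v : Fin m → ZMod 3) :
    soloBlindDigFun m w v = ∑ a : Fin m, soloBlindDig w a * v a := by
  simp [soloBlindDigFun, LinearMap.sum_apply]

/-- The test functional on an indicator is the letter sum. -/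
theorem soloBlindDigFun_indicator (m w M : ℕ) :
    soloBlindDigFun m w ((↑(soloBlindDecSet m M) : Set (Fin m)).indicator 1) = soloBlindTSum m w M false := by
  rw [soloBlindDigFun_apply]
  unfold soloBlindTSum
  simp only [Bool.false_eq_true, if_false, add_zero]
  rw [← Finset.sum_subset (Finset.subset_univ (soloBlindDecSet m M))]
  · refine Finset.sum_congr rfl fun a ha => ?_
    rw [Set.indicator_of_mem (Finset.mem_coe.mpr ha), Pi.one_apply, mul_one]
  · intro a _ ha
    rw [Set.indicator_of_notMem (fun h => ha (Finset.mem_coe.mp h)), mul_zero]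

/-- The test functional on a difference vector. -/
theorem soloBlindDigFun_vdiff (m w M C₀ : ℕ) :
    soloBlindDigFun m w (soloBlindVDiff m M C₀) = soloBlindTSum m w M false - soloBlindTSum m w C₀ false := by
  unfold soloBlindVDiff
  rw [map_sub, soloBlindDigFun_indicator, soloBlindDigFun_indicator]

/-- The tabulated test `soloBlindWDiffZero` is the vanishing of the test functional. -/
theorem soloBlind_wDiffZero_iff {m w M C₀ : ℕ} (hw : w < 3 ^ m) (hM : M < 2 ^ m) (hC₀ : C₀ < 2 ^ m) :
    soloBlindWDiffZero (soloBlindMkFlatTabs m) m w M C₀ = true ↔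
      soloBlindDigFun m w (soloBlindVDiff m M C₀) = 0 := by
  have hw3 : w < 3 ^ (m + 1) := lt_of_lt_of_le hw (Nat.pow_le_pow_right (by norm_num) (by omega))
  unfold soloBlindWDiffZero
  rw [beq_iff_eq, soloBlind_flatTabs_ts hw3 hM, soloBlind_flatTabs_ts hw3 hC₀, soloBlindDigFun_vdiff,
    sub_eq_zero, (ZMod.val_injective _).eq_iff]

/-- A SEPARATED MEMBER ENLARGES THE SPAN: if the checker finds a separating letter vector, the
difference vector of `M` is outside the span of the chosen difference vectors. -/
theorem soloBlind_separated_lt {m C₀ : ℕ} (hC₀ : C₀ < 2 ^ m) {ch : List ℕ} (hch : ∀ M' ∈ ch, M' < 2 ^ m)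
    {M : ℕ} (hM : M < 2 ^ m) (hsep : soloBlindSeparated (soloBlindMkFlatTabs m) m C₀ ch M = true) :
    Submodule.span (ZMod 3) (soloBlindVSet m C₀ ch) <
      Submodule.span (ZMod 3) (soloBlindVSet m C₀ (ch ++ [M])) := by
  unfold soloBlindSeparated at hsep
  rw [List.any_eq_true] at hsep
  obtain ⟨w, hw, hsw⟩ := hsep
  rw [List.mem_range] at hw
  rw [Bool.and_eq_true, Bool.not_eq_true', List.all_eq_true] at hsw
  obtain ⟨hnz, hall⟩ := hsw
  have hnz' : soloBlindDigFun m w (soloBlindVDiff m M C₀) ≠ 0 := fun h0 => by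
    rw [← soloBlind_wDiffZero_iff hw hM hC₀] at h0
    rw [h0] at hnz
    exact Bool.noConfusion hnz
  have hker : Submodule.span (ZMod 3) (soloBlindVSet m C₀ ch) ≤ LinearMap.ker (soloBlindDigFun m w) := by
    rw [Submodule.span_le]
    rintro v ⟨M', hM', rfl⟩
    rw [SetLike.mem_coe, LinearMap.mem_ker]
    exact (soloBlind_wDiffZero_iff hw (hch M' hM') hC₀).mp (hall M' hM')
  have hsub : soloBlindVSet m C₀ ch ⊆ soloBlindVSet m C₀ (ch ++ [M]) := by
    rintro v ⟨M', hM', rfl⟩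
    exact ⟨M', List.mem_append_left _ hM', rfl⟩
  refine lt_of_le_of_ne (Submodule.span_mono hsub) fun heq => hnz' ?_
  have hin : soloBlindVDiff m M C₀ ∈ Submodule.span (ZMod 3) (soloBlindVSet m C₀ ch) := by
    rw [heq]
    exact Submodule.subset_span ⟨M, List.mem_append_right _ (List.mem_singleton_self _), rfl⟩
  exact LinearMap.mem_ker.mp (hker hin)

/-- The greedy pass only appends members of the pending list. -/
theorem soloBlind_flatGreedy_subset (T : SoloBlindFlatTabs) (m C₀ : ℕ) :
    ∀ rest ch : List ℕ, ∀ M ∈ soloBlindFlatGreedy T m C₀ rest ch, M ∈ ch ∨ M ∈ rest := by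
  intro rest
  induction rest with
  | nil => intro ch M hM; exact Or.inl hM
  | cons M₁ rest ih =>
    intro ch M hM
    unfold soloBlindFlatGreedy at hM
    split at hM
    · rcases ih _ M hM with h | h
      · rcases List.mem_append.mp h with h | h
        · exact Or.inl h
        · exact Or.inr (by rw [List.mem_singleton.mp h]; exact List.mem_cons_self)
      · exact Or.inr (List.mem_cons_of_mem _ h)
    · rcases ih _ M hM with h | h
      · exact Or.inl h
      · exact Or.inr (List.mem_cons_of_mem _ h)

/-- THE GREEDY INVARIANT: along the pass, the span dimension grows at least as fast as the chosen list. -/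
theorem soloBlind_flatGreedy_rank {m C₀ : ℕ} (hC₀ : C₀ < 2 ^ m) :
    ∀ rest ch : List ℕ, (∀ M ∈ rest, M < 2 ^ m) → (∀ M ∈ ch, M < 2 ^ m) →
      finrank (ZMod 3) (Submodule.span (ZMod 3) (soloBlindVSet m C₀ ch)) +
          (soloBlindFlatGreedy (soloBlindMkFlatTabs m) m C₀ rest ch).length ≤
        finrank (ZMod 3) (Submodule.span (ZMod 3)
          (soloBlindVSet m C₀ (soloBlindFlatGreedy (soloBlindMkFlatTabs m) m C₀ rest ch))) + ch.length := by
  intro rest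
  induction rest with
  | nil =>
    intro ch _ _
    show _ + ch.length ≤ _ + ch.length
    exact le_refl _
  | cons M rest ih =>
    intro ch hrest hch
    have hM : M < 2 ^ m := hrest M List.mem_cons_self
    have hrest' : ∀ M' ∈ rest, M' < 2 ^ m := fun M' h => hrest M' (List.mem_cons_of_mem _ h)
    by_cases hsep : soloBlindSeparated (soloBlindMkFlatTabs m) m C₀ ch M = true
    · have hg : soloBlindFlatGreedy (soloBlindMkFlatTabs m) m C₀ (M :: rest) ch =
          soloBlindFlatGreedy (soloBlindMkFlatTabs m) m C₀ rest (ch ++ [M]) := by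
        simp [soloBlindFlatGreedy, hsep]
      have hch' : ∀ M' ∈ ch ++ [M], M' < 2 ^ m := by
        intro M' h
        rcases List.mem_append.mp h with h | h
        · exact hch M' h
        · rw [List.mem_singleton.mp h]; exact hM
      have step := Submodule.finrank_lt_finrank_of_lt (soloBlind_separated_lt hC₀ hch hM hsep)
      have := ih (ch ++ [M]) hrest' hch'
      rw [List.length_append, List.length_singleton] at this
      rw [hg]
      omega
    · have hg : soloBlindFlatGreedy (soloBlindMkFlatTabs m) m C₀ (M :: rest) ch =
          soloBlindFlatGreedy (soloBlindMkFlatTabs m) m C₀ rest ch := by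
        simp [soloBlindFlatGreedy, hsep]
      rw [hg]
      exact ih ch hrest' hch

/-- THE `d`-CERTIFICATE IS A DIMENSION LOWER BOUND: `d ≤ dim span {1_M - 1_{C₀} : M ∈ F}`. -/
theorem soloBlind_flatD_le_finrank {m C₀ : ℕ} (hC₀ : C₀ < 2 ^ m) {F : List ℕ} (hF : ∀ M ∈ F, M < 2 ^ m) :
    soloBlindFlatD (soloBlindMkFlatTabs m) m F C₀ ≤
      finrank (ZMod 3) (Submodule.span (ZMod 3) (soloBlindVSet m C₀ F)) := by
  unfold soloBlindFlatD
  have key := soloBlind_flatGreedy_rank hC₀ F [] hF (fun _ h => nomatch h)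
  have h0 : soloBlindVSet m C₀ [] = ∅ := by
    ext v
    simp [soloBlindVSet]
  rw [h0, Submodule.span_empty, finrank_bot, zero_add, List.length_nil, add_zero] at key
  refine key.trans (Submodule.finrank_mono (Submodule.span_mono ?_))
  rintro v ⟨M, hM, rfl⟩
  rcases soloBlind_flatGreedy_subset _ m C₀ F [] M hM with h | h
  · exact nomatch h
  · exact ⟨M, h, rfl⟩

/-- In particular `d ≤ m`. -/
theorem soloBlind_flatD_le {m C₀ : ℕ} (hC₀ : C₀ < 2 ^ m) {F : List ℕ} (hF : ∀ M ∈ F, M < 2 ^ m) :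
    soloBlindFlatD (soloBlindMkFlatTabs m) m F C₀ ≤ m := by
  refine (soloBlind_flatD_le_finrank hC₀ hF).trans ?_
  have := Submodule.finrank_le (Submodule.span (ZMod 3) (soloBlindVSet m C₀ F))
  rwa [Module.finrank_fin_fun] at this

end Summit.MatrixMultiplication.MatrixMultiplication.Theorems
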